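import Summits.QuantumFields.BalabanUV.T4Continuum.Support.NE7FlatHkOrthogonal
import Summits.QuantumFields.BalabanUV.T4Continuum.Support.NE7FlatHkCurlLetter
import Summits.QuantumFields.BalabanUV.T4Continuum.Support.NE3FramePotBoundComplex
import HarnessLib

/-!
# NE7SliceGreenTestField — THE T4 ↔ TORUS DICTIONARY FOR THE SLICE SOLVER LETTER: the skew test direction `Y^{a}_{ii′}(x,κ) = a(x̄,κ)E_{ii′} − ā(x̄,κ)E_{i′i}`
# of a torus vector field `a` — skew, periodic, of straight block average `L^{k+1}·Q_k a` (hence ZERO on `ker Q_k`), with flat curl `F(a)E_{ii′} − F̄(a)E_{i′i}`,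
# `‖·‖₁ ≤ 2·card n·‖a‖₁`, and flat Hessian against a skew `X` equal to `(2∕card n)·Re⟨F(a), F(x_{ii′})⟩`; lit-balaban's curl pairing at lattice
# factor `n` is `2n²` times the same sum

Cell `pub-balaban`, rung (B)+1 sub-cell t4, lineage `b2b-balaban-t4-ne7-p1`, generation 72 (CRUX PROVER NE7 #1).  File G3a of the G♭ discharge (over F40a
`NE7TorusBoxDictionary`, F40b `NE7FlatHkOrthogonal`, F35 `NE7FlatAverageBridge`, F37 `NE7FlatHkCurlLetter.opNorm_le_card_mul`, row NE3's `linQ_map`).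
WHY.  G1 `NE7SliceGreenTorus.exists_sliceGreen_const` bounds every plaquette value of a `ker Q_k` torus field `x` by `K(d)·g` once `|⟨∂a, ∂x⟩| ≤ g‖a‖₁` for
all torus fields `a ∈ ker Q_k`.  The END F55 supplies its hypothesis on the T4 side: `|hess 1 X Y| ≤ g‖Y‖₁` for skew periodic TANGENT `Y`.  To pass from one to
the other (sequel G3b) one needs, for every complex torus field `a`, a skew periodic T4 direction whose flat Hessian against `X` reads the complex pairing
`⟨∂a, ∂x_{ii′}⟩` of `a` with the `(i,i′)` entry of `X`: this is `Y^{a}_{ii′}` (real part) and `Y^{I·a}_{ii′}` (imaginary part).  THIS FILE is that dictionary.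
WHAT ([folklore]; 0 def, 0 sorry; general dimension; the test direction is written out as the lambda
`fun x κ => Matrix.single i i′ (a (toT F x, κ)) − Matrix.single i′ i (star (a (toT F x, κ)))`).  §1 torus conjugation bookkeeping (`QvOp_mulVec_star`,
`Fs_one_star`, `Fs_one_smul`); §2 the test direction: `isSkewDir_test`, `toT_add_period`, `isPeriodicDir_test`, `curlAt_flat_test`, `norm_test_le`,
`dirL1_test_le`, **`Qcoarse_iterate_test`** (`(Qcoarse L)^[k+1] Y^{a} = Y^{L^{k+1}·Q_k a}` read through F35, so `= 0` for `a ∈ ker Q_k`: `Qcoarse_iterate_test_eq_zero`);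
§3 the pairings: **`hess_flat_test`** (`hess 1 X Y^{a} (perWin) = (2∕card n)·Re Σ_{p∈perWin} conj(F¹(a)(p))·F¹(x_{ii′})(p)` for skew periodic `X`) and
**`curl_pairing_eq`** (`⟨∂_n a, ∂_n x⟩ = 2n²·Σ_{p∈perWin} conj(F¹(a)(p))·F¹(x)(p)`, ordered pairs ↔ planes, torus ↔ period box).
HONEST FRAMING (page 1): index bookkeeping between two typed dictionaries; nothing of Bałaban's asserted; NOT (APE), NOT ONE-STEP, NOT NE7; spine 0∕9; finite
T⁴ rung (B)+1 — NOT infinite volume, NOT mass gap, NOT Clay.  Continuum YM on T⁴ ⇐ BetaPertH ∧ nine spine estimates (0/9 proved); BetaPertH ⇐ (D1) ∧ (D4) ∧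
CAP+tail; G-an2-4 gates asym, D1 and NE2/3/4.
-/

set_option autoImplicit false

open scoped BigOperators Matrix ComplexConjugate Matrix.Norms.L2Operator
open Finset

namespace Summit.QuantumFields.BalabanUV.T4Continuum.NE7SliceGreenTestField

open Literature.MathematicalPhysics.QuantumFieldTheory.Balaban1983to89
open B7Prop1Explicit (Site e e_apply)
open T4AveragingDeficitWall (curlAt curl IsSkewDir SmallField dirL1)
open T4AveragingDeficitWallBoundary (periodBox)
open AveragingDeficitPeriodicCounting (IsPeriodicDir)
open B5Prop11Plancherel (Tor fine unitVec)
open B5Action121 (Fs Fs_apply CurlOp CurlOp_mulVec)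
open B5Block118 (QvOp QvOp_mulVec lineSum)
open B6LowerBound2153Torus (toT rep toT_rep)
open BlockAveragePushDirSplit (flat)
open NE3TangentFlatStructure (Qcoarse Qcoarse_add_period linQ_sub)
open NE3SmoothRightInverseFlat (iterate_Qcoarse_apply)
open NE3FramePotBoundComplex (linQ_map)
open NE3SmoothLiftCurl (curlAt_flat_eq)
open NE3FlatHessianCurl (smallField_flatCfg_zero)
open NE3TangentFlatPush (flatCfg_eq_flat)
open NE3HessForm (hess)
open NE3HessBounds (curlAt_mem_skewAdjoint)
open NE3FramePotBound (isUnitaryCfg_flat)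
open MinimalActionLevels (perWin)
open NE7ApeFlatSkeleton (hess_flat)
open NE7FlatAverageBridge (linQ_pullback_eq)
open NE7FlatHkOrthogonal (Fs_eq_mul_Fs_one entry_eq_neg_conj_of_skew)
open NE7FlatHkCurlLetter (opNorm_le_card_mul)
open NE7TorusBoxDictionary (sum_periodBox_toT sum_sum_eq_two_mul_sum_plane_complex toT_add_e' apply_rep_toT' curlAt_flat_entry_torus)

noncomputable section

variable {d : ℕ} {n : Type*} [Fintype n] [DecidableEq n]

/-! ## §1 Conjugation and scalars through lit-balaban's `Q_k` and `F¹` -/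

section Torus

omit [Fintype n] [DecidableEq n]

/-- `Q_k` has real entries: `Q_k(ā) = conj(Q_k a)`. [folklore] -/
theorem QvOp_mulVec_star (nn : ℕ) [NeZero nn] (M : Fin d → ℕ) [∀ μ, NeZero (M μ)] (a : Tor (fine nn M) × Fin d → ℂ) :
    QvOp nn M *ᵥ (star a) = star (QvOp nn M *ᵥ a) := by
  funext b
  obtain ⟨y, μ⟩ := b
  rw [Pi.star_apply, QvOp_mulVec, QvOp_mulVec, star_mul', star_sum]
  congr 1
  · rw [star_div₀, star_one, star_pow, Complex.star_def, Complex.conj_natCast]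
  · refine Finset.sum_congr rfl fun j _ => ?_
    simp only [lineSum, star_sum, Pi.star_apply]

/-- `F¹(ā) = conj F¹(a)`. [folklore] -/
theorem Fs_one_star (N : Fin d → ℕ) [∀ μ, NeZero (N μ)] (a : Tor N × Fin d → ℂ) (μ ν : Fin d) (t : Tor N) :
    Fs N 1 (star a) μ ν t = star (Fs N 1 a μ ν t) := by
  rw [Fs_apply, Fs_apply, one_mul, one_mul]
  simp only [Pi.star_apply, star_add, star_sub]

/-- `F¹(c·a) = c·F¹(a)`. [folklore] -/
theorem Fs_one_smul (N : Fin d → ℕ) [∀ μ, NeZero (N μ)] (c : ℂ) (a : Tor N × Fin d → ℂ) (μ ν : Fin d) (t : Tor N) :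
    Fs N 1 (c • a) μ ν t = c * Fs N 1 a μ ν t := by
  rw [Fs_apply, Fs_apply, one_mul, one_mul]
  simp only [Pi.smul_apply, smul_eq_mul]
  ring

end Torus

/-! ## §2 The skew test direction of a torus field -/

omit [Fintype n] in
/-- `Y^{a}_{ii′}` is skew (`(cE_{ii′} − c̄E_{i′i})ᴴ = c̄E_{i′i} − cE_{ii′}`). [folklore] -/
theorem isSkewDir_test (F : Fin d → ℕ) [∀ μ, NeZero (F μ)] (a : Tor F × Fin d → ℂ) (i i' : n) :
    IsSkewDir (fun (x : Site d) (κ : Fin d) => Matrix.single i i' (a (toT F x, κ)) - Matrix.single i' i (star (a (toT F x, κ)))) := by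
  intro x κ
  rw [skewAdjoint.mem_iff, star_sub, Matrix.star_eq_conjTranspose, Matrix.star_eq_conjTranspose, Matrix.conjTranspose_single,
    Matrix.conjTranspose_single, star_star]
  exact (neg_sub _ _).symm

omit [Fintype n] [DecidableEq n] in
/-- The cubic torus does not see its period vectors. [folklore] -/
theorem toT_add_period (P : ℕ) (x : Site d) (κ : Fin d) :
    toT (fun _ : Fin d => P) (x + (P : ℤ) • e κ) = toT (fun _ : Fin d => P) x := by
  funext ν
  simp only [toT, Pi.add_apply, Pi.smul_apply, smul_eq_mul, Int.cast_add, Int.cast_mul, Int.cast_natCast, ZMod.natCast_self, zero_mul,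
    add_zero]

omit [Fintype n] in
/-- `Y^{a}_{ii′}` is `P`-periodic on the cubic torus of period `P`. [folklore] -/
theorem isPeriodicDir_test (P : ℕ) [NeZero P] (a : Tor (fun _ : Fin d => P) × Fin d → ℂ) (i i' : n) :
    IsPeriodicDir (fun (x : Site d) (κ : Fin d) =>
      Matrix.single i i' (a (toT (fun _ : Fin d => P) x, κ)) - Matrix.single i' i (star (a (toT (fun _ : Fin d => P) x, κ)))) (P : ℤ) := by
  intro x κ μ
  simp only [toT_add_period]

/-- **THE FLAT CURL OF THE TEST DIRECTION**: `curl 1 Y^{a}_{ii′} (z;μ,ν) = F¹(a)(z̄;μ,ν)E_{ii′} − conj(F¹(a)(z̄;μ,ν))E_{i′i}`. [folklore] -/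
theorem curlAt_flat_test (F : Fin d → ℕ) [∀ μ, NeZero (F μ)] (a : Tor F × Fin d → ℂ) (i i' : n) (z : Site d) (μ ν : Fin d) :
    curlAt (flat (d := d) (n := n))
        (fun (x : Site d) (κ : Fin d) => Matrix.single i i' (a (toT F x, κ)) - Matrix.single i' i (star (a (toT F x, κ)))) z μ ν
      = Matrix.single i i' (Fs F 1 a μ ν (toT F z)) - Matrix.single i' i (star (Fs F 1 a μ ν (toT F z))) := by
  rw [curlAt_flat_eq, Fs_apply, one_mul, toT_add_e', toT_add_e']
  ext j j'
  simp only [Matrix.sub_apply, Matrix.single_apply, star_add, star_sub]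
  split_ifs <;> ring

/-- Entries of the test direction are at most `2|a|`; hence `‖Y^{a}_{ii′}(x,κ)‖ ≤ 2·card n·|a(x̄,κ)|`. [folklore] -/
theorem norm_test_le [Nonempty n] (F : Fin d → ℕ) [∀ μ, NeZero (F μ)] (a : Tor F × Fin d → ℂ) (i i' : n) (x : Site d) (κ : Fin d) :
    ‖Matrix.single i i' (a (toT F x, κ)) - Matrix.single i' i (star (a (toT F x, κ)))‖ ≤ Fintype.card n * (2 * ‖a (toT F x, κ)‖) := by
  refine opNorm_le_card_mul _ fun j j' => ?_
  rw [Matrix.sub_apply, Matrix.single_apply, Matrix.single_apply]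
  have h1 : ‖(if i = j ∧ i' = j' then a (toT F x, κ) else 0)‖ ≤ ‖a (toT F x, κ)‖ := by split_ifs <;> simp
  have h2 : ‖(if i' = j ∧ i = j' then star (a (toT F x, κ)) else 0)‖ ≤ ‖a (toT F x, κ)‖ := by split_ifs <;> simp
  calc _ ≤ ‖(if i = j ∧ i' = j' then a (toT F x, κ) else 0)‖ + ‖(if i' = j ∧ i = j' then star (a (toT F x, κ)) else 0)‖ := norm_sub_le _ _
    _ ≤ _ := by linarith

/-- **`‖Y^{a}_{ii′}‖_{ℓ¹([0,P)^d)} ≤ 2·card n·‖a‖₁`** on the cubic torus of period `P`. [folklore] -/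
theorem dirL1_test_le [Nonempty n] (P : ℕ) [NeZero P] (a : Tor (fun _ : Fin d => P) × Fin d → ℂ) (i i' : n) :
    dirL1 (fun (x : Site d) (κ : Fin d) =>
        Matrix.single i i' (a (toT (fun _ : Fin d => P) x, κ)) - Matrix.single i' i (star (a (toT (fun _ : Fin d => P) x, κ)))) (periodBox P)
      ≤ 2 * Fintype.card n * ∑ j, ‖a j‖ := by
  unfold dirL1
  have hsum : ∑ x ∈ periodBox (d := d) P, ∑ κ : Fin d, ‖a (toT (fun _ : Fin d => P) x, κ)‖ = ∑ j, ‖a j‖ := by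
    have h := sum_periodBox_toT (d := d) P (fun t => ((∑ κ : Fin d, ‖a (t, κ)‖ : ℝ) : ℂ))
    rw [Fintype.sum_prod_type]
    exact_mod_cast h
  calc ∑ x ∈ periodBox P, ∑ κ : Fin d, ‖Matrix.single i i' (a (toT (fun _ : Fin d => P) x, κ)) - Matrix.single i' i (star (a (toT (fun _ : Fin d => P) x, κ)))‖
      ≤ ∑ x ∈ periodBox P, ∑ κ : Fin d, Fintype.card n * (2 * ‖a (toT (fun _ : Fin d => P) x, κ)‖) :=
        Finset.sum_le_sum fun x _ => Finset.sum_le_sum fun κ _ => norm_test_le _ a i i' x κ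
    _ = 2 * Fintype.card n * ∑ x ∈ periodBox (d := d) P, ∑ κ : Fin d, ‖a (toT (fun _ : Fin d => P) x, κ)‖ := by
        simp only [Finset.mul_sum]
        refine Finset.sum_congr rfl fun x _ => Finset.sum_congr rfl fun κ _ => by ring
    _ = _ := by rw [hsum]

/-- **THE STRAIGHT `(k+1)`-FOLD AVERAGE OF THE TEST DIRECTION IS THE TEST DIRECTION OF `L^{k+1}·Q_k a`** (F35 `linQ_pullback_eq` entry by entry, periodicity
of the coarse average, `Q_k` of a conjugate). [folklore] -/
theorem Qcoarse_iterate_test (L k N : ℕ) [NeZero N] [NeZero (L ^ (k + 1))] (a : Tor (fine (L ^ (k + 1)) (fun _ : Fin d => N)) × Fin d → ℂ) (i i' : n)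
    (z : Site d) (κ : Fin d) :
    (Qcoarse L)^[k + 1] (fun (x : Site d) (μ : Fin d) =>
        Matrix.single i i' (a (toT (fine (L ^ (k + 1)) (fun _ : Fin d => N)) x, μ))
          - Matrix.single i' i (star (a (toT (fine (L ^ (k + 1)) (fun _ : Fin d => N)) x, μ)))) z κ
      = Matrix.single i i' (((L ^ (k + 1) : ℕ) : ℂ) * (QvOp (L ^ (k + 1)) (fun _ : Fin d => N) *ᵥ a) (toT (fun _ : Fin d => N) z, κ))
          - Matrix.single i' i (star (((L ^ (k + 1) : ℕ) : ℂ) * (QvOp (L ^ (k + 1)) (fun _ : Fin d => N) *ᵥ a) (toT (fun _ : Fin d => N) z, κ))) := by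
  haveI : NeZero (L ^ (k + 1) * N) := ⟨Nat.mul_ne_zero (NeZero.ne _) (NeZero.ne N)⟩
  set Y : Site d → Fin d → Matrix n n ℂ :=
    fun x μ => Matrix.single i i' (a (toT (fine (L ^ (k + 1)) (fun _ : Fin d => N)) x, μ)) - Matrix.single i' i (star (a (toT (fine (L ^ (k + 1)) (fun _ : Fin d => N)) x, μ))) with hY
  -- the iterate is the one-shot coarse straight average at `L^{k+1}`
  have hQc : ∀ (w : Site d) (τ : Fin d), (Qcoarse L)^[k + 1] Y w τ = Qcoarse (L ^ (k + 1)) Y w τ := by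
    intro w τ
    rw [iterate_Qcoarse_apply]
    rfl
  -- `Y` is `(L^{k+1}N)`-periodic, so its coarse average is `N`-periodic
  have hYP : IsPeriodicDir Y ((L ^ (k + 1) * N : ℕ) : ℤ) := isPeriodicDir_test (d := d) (L ^ (k + 1) * N) a i i'
  have hQP : IsPeriodicDir (Qcoarse (L ^ (k + 1)) Y) (N : ℤ) := fun w τ μ =>
    Qcoarse_add_period (L ^ (k + 1)) Y (P := (N : ℤ)) (fun y τ' μ' => by have := hYP y τ' μ'; push_cast at this; exact this) w τ μ
  rw [hQc, ← apply_rep_toT' hQP z κ]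
  -- at a representative: F35 entrywise through the two linear pieces
  show B7Prop3Flat.linQ (L ^ (k + 1)) Y (((L ^ (k + 1) : ℕ) : ℤ) • rep (fun _ : Fin d => N) (toT (fun _ : Fin d => N) z)) κ = _
  have hsplit : Y = fun x μ => (fun x μ => Matrix.single i i' (a (toT (fine (L ^ (k + 1)) (fun _ : Fin d => N)) x, μ))) x μ
      - (fun x μ => Matrix.single i' i ((star a) (toT (fine (L ^ (k + 1)) (fun _ : Fin d => N)) x, μ))) x μ := by
    funext x μ; rfl
  rw [hsplit, linQ_sub]
  have h1 := linQ_map (Matrix.singleLinearMap ℂ i i' : ℂ →ₗ[ℂ] Matrix n n ℂ) (L ^ (k + 1)) (fun x μ => a (toT (fine (L ^ (k + 1)) (fun _ : Fin d => N)) x, μ))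
    (((L ^ (k + 1) : ℕ) : ℤ) • rep (fun _ : Fin d => N) (toT (fun _ : Fin d => N) z)) κ
  have h2 := linQ_map (Matrix.singleLinearMap ℂ i' i : ℂ →ₗ[ℂ] Matrix n n ℂ) (L ^ (k + 1)) (fun x μ => (star a) (toT (fine (L ^ (k + 1)) (fun _ : Fin d => N)) x, μ))
    (((L ^ (k + 1) : ℕ) : ℤ) • rep (fun _ : Fin d => N) (toT (fun _ : Fin d => N) z)) κ
  simp only [Matrix.singleLinearMap_apply] at h1 h2
  rw [h1, h2, linQ_pullback_eq, linQ_pullback_eq, QvOp_mulVec_star, Pi.star_apply, star_mul', Complex.star_def, Complex.conj_natCast]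

/-- hence **for `a ∈ ker Q_k` the test direction has vanishing straight `(k+1)`-fold average**. [folklore] -/
theorem Qcoarse_iterate_test_eq_zero (L k N : ℕ) [NeZero N] [NeZero (L ^ (k + 1))] (a : Tor (fine (L ^ (k + 1)) (fun _ : Fin d => N)) × Fin d → ℂ)
    (ha : QvOp (L ^ (k + 1)) (fun _ : Fin d => N) *ᵥ a = 0) (i i' : n) :
    (Qcoarse L)^[k + 1] (fun (x : Site d) (μ : Fin d) =>
        Matrix.single i i' (a (toT (fine (L ^ (k + 1)) (fun _ : Fin d => N)) x, μ))
          - Matrix.single i' i (star (a (toT (fine (L ^ (k + 1)) (fun _ : Fin d => N)) x, μ)))) = 0 := by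
  funext z κ
  rw [Qcoarse_iterate_test, ha]
  simp

/-! ## §3 The pairings: flat Hessian against the test direction; lit-balaban's curl pairing -/

/-- **THE FLAT HESSIAN AGAINST THE TEST DIRECTION READS THE COMPLEX CURL PAIRING OF ONE ENTRY**: for `X` skew and `P`-periodic and any torus field `a`,
`hess 1 X Y^{a}_{ii′} (perWin d P) = (2∕card n)·Re Σ_{p∈perWin} conj(F¹(a)(p))·F¹(x_{ii′})(p)`, `x_{ii′}(q) = X(rep q)_{ii′}` (F38 `hess_flat`: the flat Hessian
is the curl pairing; `tr(E_{ii′}C) = C_{i′i} = −conj C_{ii′}` for skew `C`). [folklore] -/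
theorem hess_flat_test {P : ℕ} [NeZero P] {X : Site d → Fin d → Matrix n n ℂ} (hXs : IsSkewDir X) (hXP : IsPeriodicDir X (P : ℤ))
    (a : Tor (fun _ : Fin d => P) × Fin d → ℂ) (i i' : n) :
    hess (flat (d := d) (n := n)) X
        (fun (x : Site d) (κ : Fin d) =>
          Matrix.single i i' (a (toT (fun _ : Fin d => P) x, κ)) - Matrix.single i' i (star (a (toT (fun _ : Fin d => P) x, κ)))) (perWin d P)
      = 2 / Fintype.card n
          * (∑ p ∈ perWin d P, conj (Fs (fun _ : Fin d => P) 1 a p.2.1.1 p.2.1.2 (toT (fun _ : Fin d => P) p.1))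
              * Fs (fun _ : Fin d => P) 1 (fun q : Tor (fun _ : Fin d => P) × Fin d => X (rep (fun _ : Fin d => P) q.1) q.2 i i')
                  p.2.1.1 p.2.1.2 (toT (fun _ : Fin d => P) p.1)).re := by
  set x : Tor (fun _ : Fin d => P) × Fin d → ℂ := fun q => X (rep (fun _ : Fin d => P) q.1) q.2 i i' with hx
  have hflat0 : SmallField (flat (d := d) (n := n)) 0 := by rw [← flatCfg_eq_flat]; exact smallField_flatCfg_zero
  rw [hess_flat hflat0]
  -- one plaquette
  have hterm : ∀ p : T4AveragingDeficitWall.Plaq d,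
      UnitaryModel.nReTr (curl (flat (d := d) (n := n))
          (fun (y : Site d) (κ : Fin d) => Matrix.single i i' (a (toT (fun _ : Fin d => P) y, κ)) - Matrix.single i' i (star (a (toT (fun _ : Fin d => P) y, κ)))) p
        * curl (flat (d := d) (n := n)) X p)
        = -(2 / Fintype.card n * (conj (Fs (fun _ : Fin d => P) 1 a p.2.1.1 p.2.1.2 (toT (fun _ : Fin d => P) p.1)) * Fs (fun _ : Fin d => P) 1 x p.2.1.1 p.2.1.2 (toT (fun _ : Fin d => P) p.1)).re) := by
    intro p
    set u : ℂ := Fs (fun _ : Fin d => P) 1 a p.2.1.1 p.2.1.2 (toT (fun _ : Fin d => P) p.1) with hu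
    set v : ℂ := Fs (fun _ : Fin d => P) 1 x p.2.1.1 p.2.1.2 (toT (fun _ : Fin d => P) p.1) with hv
    have hcurlY : curl (flat (d := d) (n := n))
        (fun (y : Site d) (κ : Fin d) => Matrix.single i i' (a (toT (fun _ : Fin d => P) y, κ)) - Matrix.single i' i (star (a (toT (fun _ : Fin d => P) y, κ)))) p
          = Matrix.single i i' u - Matrix.single i' i (star u) := curlAt_flat_test (fun _ : Fin d => P) a i i' p.1 p.2.1.1 p.2.1.2
    have hCii' : curl (flat (d := d) (n := n)) X p i i' = v := curlAt_flat_entry_torus (P := P) hXP p.1 p.2.1.1 p.2.1.2 i i'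
    have hCi'i : curl (flat (d := d) (n := n)) X p i' i = -conj v := by
      rw [← hCii']
      exact entry_eq_neg_conj_of_skew (curlAt_mem_skewAdjoint isUnitaryCfg_flat hXs p.1 p.2.1.1 p.2.1.2) i' i
    unfold UnitaryModel.nReTr
    rw [hcurlY, Matrix.sub_mul, Matrix.trace_sub, Matrix.trace_single_mul, Matrix.trace_single_mul, hCii', hCi'i, smul_eq_mul, smul_eq_mul,
      Complex.star_def]
    have hre : (u * -conj v - conj u * v).re = -(2 * (conj u * v).re) := by
      simp only [Complex.sub_re, Complex.mul_re, Complex.neg_re, Complex.neg_im, Complex.conj_re, Complex.conj_im]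
      ring
    rw [hre]
    ring
  rw [Finset.sum_congr rfl fun p _ => hterm p, Finset.sum_neg_distrib, neg_neg, ← Finset.mul_sum, Complex.re_sum]

/-- **lit-balaban's CURL PAIRING AT LATTICE FACTOR `n` IS `2n²` TIMES THE PLANE SUM OVER THE PERIOD BOX**:
`⟨∂_n a, ∂_n b⟩ = 2n²·Σ_{p∈perWin d P} conj(F¹(a)(p))·F¹(b)(p)` on the cubic torus of period `P` (`F_n = n·F¹`, ordered pairs ↔ planes, torus ↔ box). [folklore] -/
theorem curl_pairing_eq (P : ℕ) [NeZero P] (c : ℂ) (a b : Tor (fun _ : Fin d => P) × Fin d → ℂ) :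
    star (CurlOp (fun _ : Fin d => P) c *ᵥ a) ⬝ᵥ (CurlOp (fun _ : Fin d => P) c *ᵥ b)
      = 2 * (conj c * c) * ∑ p ∈ perWin d P, conj (Fs (fun _ : Fin d => P) 1 a p.2.1.1 p.2.1.2 (toT (fun _ : Fin d => P) p.1))
          * Fs (fun _ : Fin d => P) 1 b p.2.1.1 p.2.1.2 (toT (fun _ : Fin d => P) p.1) := by
  -- expand the dot product over `(t, (μ, ν))`
  have hexp : star (CurlOp (fun _ : Fin d => P) c *ᵥ a) ⬝ᵥ (CurlOp (fun _ : Fin d => P) c *ᵥ b)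
      = ∑ t : Tor (fun _ : Fin d => P), ∑ μ : Fin d, ∑ ν : Fin d, conj (Fs (fun _ : Fin d => P) c a μ ν t) * Fs (fun _ : Fin d => P) c b μ ν t := by
    rw [dotProduct, Fintype.sum_prod_type]
    refine Finset.sum_congr rfl fun t _ => ?_
    rw [Fintype.sum_prod_type]
    refine Finset.sum_congr rfl fun μ _ => Finset.sum_congr rfl fun ν _ => ?_
    rw [Pi.star_apply, CurlOp_mulVec, CurlOp_mulVec, RCLike.star_def]
  -- lattice factor
  have hfac : ∀ (μ ν : Fin d) (t : Tor (fun _ : Fin d => P)), conj (Fs (fun _ : Fin d => P) c a μ ν t) * Fs (fun _ : Fin d => P) c b μ ν t = (conj c * c) * (conj (Fs (fun _ : Fin d => P) 1 a μ ν t) * Fs (fun _ : Fin d => P) 1 b μ ν t) := by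
    intro μ ν t
    rw [Fs_eq_mul_Fs_one (fun _ : Fin d => P) c a, Fs_eq_mul_Fs_one (fun _ : Fin d => P) c b, map_mul]
    ring
  -- planes
  have hpl : ∀ t : Tor (fun _ : Fin d => P), ∑ μ : Fin d, ∑ ν : Fin d, conj (Fs (fun _ : Fin d => P) 1 a μ ν t) * Fs (fun _ : Fin d => P) 1 b μ ν t
      = 2 * ∑ π : T4AveragingDeficitWall.Plane d, conj (Fs (fun _ : Fin d => P) 1 a π.1.1 π.1.2 t) * Fs (fun _ : Fin d => P) 1 b π.1.1 π.1.2 t := by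
    intro t
    exact sum_sum_eq_two_mul_sum_plane_complex (fun μ ν => conj (Fs (fun _ : Fin d => P) 1 a μ ν t) * Fs (fun _ : Fin d => P) 1 b μ ν t) (fun μ => by simp [Fs_apply])
      (fun μ ν => by
        have a1 : Fs (fun _ : Fin d => P) 1 a ν μ t = -Fs (fun _ : Fin d => P) 1 a μ ν t := by rw [Fs_apply, Fs_apply]; ring
        have a2 : Fs (fun _ : Fin d => P) 1 b ν μ t = -Fs (fun _ : Fin d => P) 1 b μ ν t := by rw [Fs_apply, Fs_apply]; ring
        simp only [a1, a2, map_neg, neg_mul_neg])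
  rw [hexp]
  simp only [hfac, ← Finset.mul_sum]
  rw [Finset.sum_congr rfl fun t _ => hpl t, ← Finset.mul_sum]
  -- torus ↔ period box
  unfold perWin
  rw [Finset.sum_product, sum_periodBox_toT (d := d) P
    (fun t => ∑ π : T4AveragingDeficitWall.Plane d, conj (Fs (fun _ : Fin d => P) 1 a π.1.1 π.1.2 t) * Fs (fun _ : Fin d => P) 1 b π.1.1 π.1.2 t)]
  ring

end

end Summit.QuantumFields.BalabanUV.T4Continuum.NE7SliceGreenTestField
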